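import Mathlib.NumberTheory.LegendreSymbol.QuadraticChar.Basic
import Mathlib.NumberTheory.DirichletCharacter.Basic
import Literature.NumberTheory.Automorphic.BCDTTheoremBWildAtThreeNormalised
import HarnessLib

/-!
# The quadratic characters `ε₋₃`, `ε₅` of `Γ_ℚ` and the Dirichlet characters `(·/3)`, `(·/5)`
# they match (BCDT §2.2, "twisting by a quadratic character")

Topic `NumberTheory/Automorphic`; a sibling of `BCDTTheoremBWildAtThreeNormalised` (everything here
is proved; the four `def`s are concrete characters), landed by the tenured seat of the named fact
`Literature.NumberTheory.Automorphic.BCDT.theoremB` (Breuil–Conrad–Diamond–Taylor 2001,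
Thm. B = Thm. 2.2.1) for the step *"up to equivalence and twisting by a quadratic character"* of the
printed proof (J. Amer. Math. Soc. 14 (2001), §2.2, p. 860).

To read the modularity of `ρ̄` off the modularity of a twist `ρ̄ ⊗ χ` in the tree's wording
(`ModPGaloisRep.IsModular`; the twist step `exists_isNewform0_packet_twist` of
`BCDTModularityTwistProofs`) one needs, for each quadratic character `χ : Γ_ℚ → 𝔽₅^×` used, a
primitive quadratic Dirichlet character `ψ mod m` **matched** by `χ`: `χ` is trivial on the inertia
groups above every `p ∤ m` and `χ(Frob_p) = ψ(p)` there.  This file supplies the two characters of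
the normalisation and their matches:

* `ε₋₃ = sign ∘ χ̄₃` (`epsNegThree`, `BCDTTheoremBWildAtThreeNormalised`: the twist attaining
  "`-1 ↦ 1`" on inertia at `3`) matches `ψ₃ = (·/3)` (`psiThree`, Mathlib's `quadraticChar (ZMod 3)`
  pushed to `ℂ`; primitive of conductor `3`): `epsNegThree_eq_one_of_mem_inertia_of_ne_three`,
  `epsNegThree_matches_psiThree`;
* `ε₅ = χ̄₅²` (`epsFive`, **new here**: the quadratic character of `ℚ(√5)`, ramified only at `5`,
  with `ε₅(Frob₃) = 9 = -1`) matches `ψ₅ = (·/5)` (`psiFive`, conductor `5`):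
  `epsFive_eq_one_of_mem_inertia_of_ne_five`, `epsFive_matches_psiFive`; at `3`:
  `epsFive_eq_one_of_mem_inertia_three`, `epsFive_of_isArithFrobAt_three` (`= -1`).

Why `ε₅` rather than the `ε₋₁ = sign ∘ χ̄₄` of `BCDTTheoremBWildAtThreeNormalised` for the sign of
the Frobenius at `3`: both are unramified at `3` with value `-1` at `Frob₃`, but `ε₅` is ramified
only at `ℓ = 5`, which the modularity predicate excepts anyway, whereas `ε₋₁` is ramified at `2`,
where the level of the twisted newform is not controlled (see `BCDTModularityTwistProofs`).  BCDT
only ask for "a quadratic character" (p. 860), so either choice renders the printed proof.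

Also: `DirichletCharacter.isPrimitive_of_prime_of_ne_one` (a non-trivial character of prime level
is primitive) and `natCast_primesEquiv_mem_asIdeal`.

## References

* [BCDTJAMS2001] C. Breuil, B. Conrad, F. Diamond, R. Taylor, J. Amer. Math. Soc. 14 (2001),
  §2.2, proof of Thm. 2.2.1 (p. 860).
* L. C. Washington, *Introduction to Cyclotomic Fields*, GTM 83, Prop. 2.3, Lemma 2.12 ff.
  (`χ_N` unramified at `p ∤ N`, `χ_N(Frob_p) = p`).
-/

noncomputable section

open scoped NumberField
open Field IsDedekindDomain

namespace Literature.NumberTheory.Automorphic.BCDT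

open GaloisRepresentations Rat.HeightOneSpectrum

/-! ## Generalities -/

/-- **A non-trivial Dirichlet character of prime level is primitive**: its conductor divides the
prime level and is not `1`. [folklore] -/
theorem DirichletCharacter.isPrimitive_of_prime_of_ne_one {R : Type*} [CommMonoidWithZero R]
    {p : ℕ} (hp : p.Prime) {χ : DirichletCharacter R p} (hχ : χ ≠ 1) : χ.IsPrimitive := by
  haveI : NeZero p := ⟨hp.ne_zero⟩
  rw [DirichletCharacter.isPrimitive_def]
  rcases (Nat.dvd_prime hp).mp (DirichletCharacter.conductor_dvd_level χ) with h | h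
  · exact absurd (DirichletCharacter.eq_one_iff_conductor_eq_one.mpr h) hχ
  · exact h

/-- The rational prime under a place `v` of `ℚ` lies in `v`. [folklore] -/
theorem natCast_primesEquiv_mem_asIdeal (v : HeightOneSpectrum (𝓞 ℚ)) :
    ((primesEquiv v : ℕ) : 𝓞 ℚ) ∈ v.asIdeal :=
  (EllipticCurves.natCast_mem_asIdeal_iff_eq_primesEquiv_symm v (primesEquiv v).2).mpr
    (by rw [Subtype.coe_eta, Equiv.symm_apply_apply])

/-- For a place `v` of `ℚ` not over `q`, the prime under `v` is not `q`. [folklore] -/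
theorem primesEquiv_ne_of_not_dvd {v : HeightOneSpectrum (𝓞 ℚ)} {q : ℕ}
    (h : ¬ (primesEquiv v : ℕ) ∣ q) : (primesEquiv v : ℕ) ≠ q := fun h' ↦ h (h' ▸ dvd_rfl)

/-! ## `ψ₃ = (·/3)` and its match with `ε₋₃` -/

/-- **The quadratic Dirichlet character mod `3`**, `ψ₃ = (·/3)` (Legendre symbol), with complex
values: Mathlib's `quadraticChar (ZMod 3)` followed by `ℤ → ℂ`. [folklore] -/
def psiThree : DirichletCharacter ℂ 3 :=
  (quadraticChar (ZMod 3)).ringHomComp (Int.castRingHom ℂ)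

/-- Unfolding: `ψ₃(a) = (a/3) ∈ ℤ ⊂ ℂ`. [folklore] -/
theorem psiThree_apply (a : ZMod 3) : psiThree a = ((quadraticChar (ZMod 3) a : ℤ) : ℂ) := rfl

/-- `ψ₃` is quadratic. [folklore] -/
theorem psiThree_isQuadratic : psiThree.IsQuadratic :=
  (quadraticChar_isQuadratic (ZMod 3)).comp _

/-- Euler's criterion mod `3`: for `a ≠ 0`, `(a/3) = 1` if `a = 1` and `= -1` otherwise. [folklore] -/
theorem quadraticChar_zmod_three {a : ZMod 3} (ha : a ≠ 0) :
    quadraticChar (ZMod 3) a = if a = 1 then 1 else -1 := by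
  rw [quadraticChar_eq_pow_of_char_ne_two (by rw [ZMod.ringChar_zmod_n]; decide) ha, ZMod.card]
  norm_num

/-- `ψ₃(2) = -1`; in particular `ψ₃ ≠ 1`. [folklore] -/
theorem psiThree_ne_one : psiThree ≠ 1 := by
  intro h
  have h2 := congrArg (fun χ : DirichletCharacter ℂ 3 ↦ χ (2 : ZMod 3)) h
  simp only [psiThree_apply, quadraticChar_zmod_three (show (2 : ZMod 3) ≠ 0 by decide),
    show (2 : ZMod 3) ≠ 1 by decide, if_false,
    MulChar.one_apply (show IsUnit (2 : ZMod 3) by decide)] at h2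
  norm_num at h2

/-- `ψ₃` is primitive (conductor `3`). [folklore] -/
theorem psiThree_isPrimitive : psiThree.IsPrimitive :=
  DirichletCharacter.isPrimitive_of_prime_of_ne_one Nat.prime_three psiThree_ne_one

/-- **`ε₋₃` is unramified away from `3`**: trivial on the inertia groups above every prime `p ≠ 3`
(`χ̄₃` is, Washington Prop. 2.3). [folklore] -/
theorem epsNegThree_eq_one_of_mem_inertia_of_ne_three {v : HeightOneSpectrum (𝓞 ℚ)}
    (hv : ¬ (primesEquiv v : ℕ) ∣ 3) {𝔓 : Ideal (absIntegers (𝓞 ℚ) ℚ)} (h𝔓 : 𝔓 ∈ v.primesAbove)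
    {τ : absoluteGaloisGroup ℚ} (hτ : τ ∈ 𝔓.inertia (absoluteGaloisGroup ℚ)) : epsNegThree τ = 1 := by
  rw [epsNegThree_eq_one_iff, modPCyclotomicCharacterZMod_eq_modNCyclotomicCharacter]
  exact Rat.modNCyclotomicCharacter_eq_one_of_mem_inertia (primesEquiv v).2 hv
    (natCast_primesEquiv_mem_asIdeal v) h𝔓 hτ

/-- **`ε₋₃(Frob_p) = ψ₃(p)` for `p ≠ 3`** (`χ̄₃(Frob_p) = p mod 3`, Washington Lemma 2.12 ff.): in
the form consumed by `exists_isNewform0_packet_twist` — if `ψ₃(p) = 1` then `ε₋₃(Frob_p) = 1`, if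
`ψ₃(p) = -1` then `ε₋₃(Frob_p) = -1`. [folklore] -/
theorem epsNegThree_matches_psiThree {v : HeightOneSpectrum (𝓞 ℚ)} (hv : ¬ (primesEquiv v : ℕ) ∣ 3)
    {𝔓 : Ideal (absIntegers (𝓞 ℚ) ℚ)} (h𝔓 : 𝔓 ∈ v.primesAbove) {σ : absoluteGaloisGroup ℚ}
    (hσ : IsArithFrobAt (𝓞 ℚ) σ 𝔓) :
    (psiThree (primesEquiv v : ℕ) = 1 → epsNegThree σ = 1) ∧
      (psiThree (primesEquiv v : ℕ) = -1 → epsNegThree σ = -1) := by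
  have hp : (primesEquiv v : ℕ).Prime := (primesEquiv v).2
  have hfrob : ((modPCyclotomicCharacterZMod ℚ 3 σ : (ZMod 3)ˣ) : ZMod 3) = (primesEquiv v : ℕ) := by
    rw [modPCyclotomicCharacterZMod_eq_modNCyclotomicCharacter]
    exact Rat.modNCyclotomicCharacter_of_isArithFrobAt hp hv (natCast_primesEquiv_mem_asIdeal v) h𝔓 hσ
  have hne : ((primesEquiv v : ℕ) : ZMod 3) ≠ 0 := by
    rw [Ne, ZMod.natCast_eq_zero_iff]
    exact fun h ↦ hv ((Nat.prime_dvd_prime_iff_eq Nat.prime_three hp).mp h ▸ dvd_rfl)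
  -- everything is a statement about the unit `u = χ̄₃(σ)` with `u = p mod 3`
  set u := modPCyclotomicCharacterZMod ℚ 3 σ with hu
  have hval : psiThree (primesEquiv v : ℕ) = ((quadraticChar (ZMod 3) (u : ZMod 3) : ℤ) : ℂ) := by
    rw [← psiThree_apply, hfrob]
  rw [hval, epsNegThree_apply, ← hu]
  clear_value u
  rcases ZMod.units_three_eq_one_or u with rfl | rfl
  · refine ⟨fun _ ↦ unitsZModThreeHom_one, fun h ↦ ?_⟩
    exfalso
    rw [Units.val_one, MulChar.map_one] at h
    norm_num at h
  · refine ⟨fun h ↦ ?_, fun _ ↦ unitsZModThreeHom_neg_one⟩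
    exfalso
    rw [Units.val_neg, Units.val_one, quadraticChar_zmod_three (by decide),
      if_neg (by decide)] at h
    norm_num at h

/-! ## `ε₅ = χ̄₅²`, `ψ₅ = (·/5)` and their match -/

/-- The mod-`5` cyclotomic character `χ̄₅ : Γ_ℚ → 𝔽₅^×` as a continuous character (the tree's
`modPCyclotomicCharacter` with `ι = id`). [folklore] -/
def cycloFive : absoluteGaloisGroup ℚ →ₜ* (ZMod 5)ˣ :=
  modPCyclotomicCharacter ℚ (ZMod 5) 5 (RingHom.id _)

/-- `cycloFive σ = χ̄₅(σ)`. [folklore] -/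
theorem cycloFive_apply (σ : absoluteGaloisGroup ℚ) :
    cycloFive σ = modPCyclotomicCharacterZMod ℚ 5 σ := by
  refine Units.ext ?_
  rfl

/-- **The quadratic character `ε₅ = χ̄₅²` of `ℚ(√5)` with values in `𝔽₅^×`**: the square of the
mod-`5` cyclotomic character, i.e. `Frob_p ↦ (p/5) = p² mod 5`.  Unramified away from `5`, with
`ε₅(Frob₃) = 9 = -1`: a quadratic character "unramified at `3` taking `Frob₃` to `-1`", used to
normalise the sign of the Frobenius in BCDT's case 2 (p. 860), ramified only at `ℓ = 5`.
[cite: BCDTJAMS2001, §2.2 (proof of Thm. 2.2.1, p. 860: "twisting by a quadratic character")] -/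
def epsFive : absoluteGaloisGroup ℚ →ₜ* (ZMod 5)ˣ :=
  cycloFive * cycloFive

/-- `ε₅(σ) = χ̄₅(σ)²`. [folklore] -/
theorem epsFive_apply (σ : absoluteGaloisGroup ℚ) :
    epsFive σ = modPCyclotomicCharacterZMod ℚ 5 σ ^ 2 := by
  rw [epsFive, ContinuousMonoidHom.mul_apply, cycloFive_apply, sq]

/-- The squares in `𝔽₅^×` are `±1`. [folklore] -/
theorem units_zmod_five_sq_eq_one_or (u : (ZMod 5)ˣ) : u ^ 2 = 1 ∨ u ^ 2 = -1 := by
  revert u; decide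

/-- `ε₅` takes only the values `±1`. [folklore] -/
theorem epsFive_eq_one_or (σ : absoluteGaloisGroup ℚ) : epsFive σ = 1 ∨ epsFive σ = -1 := by
  rw [epsFive_apply]
  exact units_zmod_five_sq_eq_one_or _

/-- `ε₅` is quadratic: `ε₅(σ)² = 1`. [folklore] -/
theorem epsFive_sq (σ : absoluteGaloisGroup ℚ) : epsFive σ ^ 2 = 1 := by
  rcases epsFive_eq_one_or σ with h | h
  · rw [h, one_pow]
  · rw [h, neg_one_sq]

/-- **`ε₅` is unramified away from `5`**: trivial on the inertia groups above every prime `p ≠ 5`.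
[folklore] -/
theorem epsFive_eq_one_of_mem_inertia_of_ne_five {v : HeightOneSpectrum (𝓞 ℚ)}
    (hv : ¬ (primesEquiv v : ℕ) ∣ 5) {𝔓 : Ideal (absIntegers (𝓞 ℚ) ℚ)} (h𝔓 : 𝔓 ∈ v.primesAbove)
    {τ : absoluteGaloisGroup ℚ} (hτ : τ ∈ 𝔓.inertia (absoluteGaloisGroup ℚ)) : epsFive τ = 1 := by
  have h : modPCyclotomicCharacterZMod ℚ 5 τ = 1 := by
    rw [modPCyclotomicCharacterZMod_eq_modNCyclotomicCharacter]
    exact Rat.modNCyclotomicCharacter_eq_one_of_mem_inertia (primesEquiv v).2 hv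
      (natCast_primesEquiv_mem_asIdeal v) h𝔓 hτ
  rw [epsFive_apply, h, one_pow]

/-- `ε₅` is trivial on the inertia groups above `3`. [folklore] -/
theorem epsFive_eq_one_of_mem_inertia_three {v : HeightOneSpectrum (𝓞 ℚ)}
    (hv : ((3 : ℕ) : 𝓞 ℚ) ∈ v.asIdeal) {𝔓 : Ideal (absIntegers (𝓞 ℚ) ℚ)} (h𝔓 : 𝔓 ∈ v.primesAbove)
    {τ : absoluteGaloisGroup ℚ} (hτ : τ ∈ 𝔓.inertia (absoluteGaloisGroup ℚ)) : epsFive τ = 1 := by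
  rw [epsFive_apply, Rat.modPCyclotomicCharacterZMod_five_eq_one_of_mem_inertia_three hv h𝔓 hτ,
    one_pow]

/-- **`ε₅(Frob₃) = -1`** (`χ̄₅(Frob₃) = 3`, `3² = 9 = -1 mod 5`). [folklore] -/
theorem epsFive_of_isArithFrobAt_three {v : HeightOneSpectrum (𝓞 ℚ)}
    (hv : ((3 : ℕ) : 𝓞 ℚ) ∈ v.asIdeal) {𝔓 : Ideal (absIntegers (𝓞 ℚ) ℚ)} (h𝔓 : 𝔓 ∈ v.primesAbove)
    {φ : absoluteGaloisGroup ℚ} (hφ : IsArithFrobAt (𝓞 ℚ) φ 𝔓) : epsFive φ = -1 := by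
  have h3 : modPCyclotomicCharacterZMod ℚ 5 φ = ⟨3, 2, by decide, by decide⟩ :=
    Units.ext (Rat.modPCyclotomicCharacterZMod_five_of_isArithFrobAt_three hv h𝔓 hφ)
  rw [epsFive_apply, h3]
  decide

/-- **The quadratic Dirichlet character mod `5`**, `ψ₅ = (·/5)`, with complex values. [folklore] -/
def psiFive : DirichletCharacter ℂ 5 :=
  (quadraticChar (ZMod 5)).ringHomComp (Int.castRingHom ℂ)

/-- Unfolding: `ψ₅(a) = (a/5) ∈ ℤ ⊂ ℂ`. [folklore] -/
theorem psiFive_apply (a : ZMod 5) : psiFive a = ((quadraticChar (ZMod 5) a : ℤ) : ℂ) := rfl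

/-- `ψ₅` is quadratic. [folklore] -/
theorem psiFive_isQuadratic : psiFive.IsQuadratic :=
  (quadraticChar_isQuadratic (ZMod 5)).comp _

/-- Euler's criterion mod `5`: for `a ≠ 0`, `(a/5) = 1` if `a² = 1` and `= -1` otherwise. [folklore] -/
theorem quadraticChar_zmod_five {a : ZMod 5} (ha : a ≠ 0) :
    quadraticChar (ZMod 5) a = if a ^ 2 = 1 then 1 else -1 := by
  rw [quadraticChar_eq_pow_of_char_ne_two (by rw [ZMod.ringChar_zmod_n]; decide) ha, ZMod.card]

/-- `ψ₅(2) = -1`; in particular `ψ₅ ≠ 1`. [folklore] -/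
theorem psiFive_ne_one : psiFive ≠ 1 := by
  intro h
  have h2 := congrArg (fun χ : DirichletCharacter ℂ 5 ↦ χ (2 : ZMod 5)) h
  simp only [psiFive_apply, quadraticChar_zmod_five (show (2 : ZMod 5) ≠ 0 by decide),
    show ¬ ((2 : ZMod 5) ^ 2 = 1) by decide, if_false,
    MulChar.one_apply (show IsUnit (2 : ZMod 5) by decide)] at h2
  norm_num at h2

/-- `ψ₅` is primitive (conductor `5`). [folklore] -/
theorem psiFive_isPrimitive : psiFive.IsPrimitive :=
  DirichletCharacter.isPrimitive_of_prime_of_ne_one Nat.prime_five psiFive_ne_one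

/-- **`ε₅(Frob_p) = ψ₅(p)` for `p ≠ 5`** (`χ̄₅(Frob_p) = p`, so `ε₅(Frob_p) = p² = (p/5) mod 5`), in
the form consumed by `exists_isNewform0_packet_twist`. [folklore] -/
theorem epsFive_matches_psiFive {v : HeightOneSpectrum (𝓞 ℚ)} (hv : ¬ (primesEquiv v : ℕ) ∣ 5)
    {𝔓 : Ideal (absIntegers (𝓞 ℚ) ℚ)} (h𝔓 : 𝔓 ∈ v.primesAbove) {σ : absoluteGaloisGroup ℚ}
    (hσ : IsArithFrobAt (𝓞 ℚ) σ 𝔓) :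
    (psiFive (primesEquiv v : ℕ) = 1 → epsFive σ = 1) ∧
      (psiFive (primesEquiv v : ℕ) = -1 → epsFive σ = -1) := by
  have hp : (primesEquiv v : ℕ).Prime := (primesEquiv v).2
  have hfrob : ((modPCyclotomicCharacterZMod ℚ 5 σ : (ZMod 5)ˣ) : ZMod 5) = (primesEquiv v : ℕ) := by
    rw [modPCyclotomicCharacterZMod_eq_modNCyclotomicCharacter]
    exact Rat.modNCyclotomicCharacter_of_isArithFrobAt hp hv (natCast_primesEquiv_mem_asIdeal v) h𝔓 hσ
  set u := modPCyclotomicCharacterZMod ℚ 5 σ with hu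
  have hval : psiFive (primesEquiv v : ℕ) = ((quadraticChar (ZMod 5) (u : ZMod 5) : ℤ) : ℂ) := by
    rw [← psiFive_apply, hfrob]
  rw [hval, epsFive_apply, ← hu, quadraticChar_zmod_five (Units.ne_zero u)]
  clear_value u
  -- a finite check over the units of `𝔽₅`
  have key : ∀ w : (ZMod 5)ˣ, ((w : ZMod 5) ^ 2 = 1 → w ^ 2 = 1) ∧
      (¬ (w : ZMod 5) ^ 2 = 1 → w ^ 2 = -1) := by decide
  obtain ⟨k1, k2⟩ := key u
  by_cases h : (u : ZMod 5) ^ 2 = 1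
  · simp only [h, if_true, Int.cast_one]
    exact ⟨fun _ ↦ k1 h, fun h' ↦ by norm_num at h'⟩
  · simp only [h, if_false, Int.cast_neg, Int.cast_one]
    exact ⟨fun h' ↦ by norm_num at h', fun _ ↦ k2 h⟩

/-! ## Twisting `ρ̄ : Γ_ℚ → GL₂(𝔽₅)` by `ε₅` -/

/-- The twist by `ε₅` preserves the determinant (`ε₅² = 1`). [folklore] -/
theorem det_twist_epsFive (ρ : ModPGaloisRep ℚ (ZMod 5) 2) (g : absoluteGaloisGroup ℚ) :
    Matrix.GeneralLinearGroup.det (ρ.twist epsFive g) = Matrix.GeneralLinearGroup.det (ρ g) := by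
  rw [FramedRep.det_twist_apply, epsFive_sq, one_mul]

/-- `ρ̄ ⊗ ε₅` agrees with `ρ̄` on the inertia groups above `3`. [folklore] -/
theorem twist_epsFive_apply_of_mem_inertia (ρ : ModPGaloisRep ℚ (ZMod 5) 2)
    {v : HeightOneSpectrum (𝓞 ℚ)} (hv : ((3 : ℕ) : 𝓞 ℚ) ∈ v.asIdeal)
    {𝔓 : Ideal (absIntegers (𝓞 ℚ) ℚ)} (h𝔓 : 𝔓 ∈ v.primesAbove) {σ : absoluteGaloisGroup ℚ}
    (hσ : σ ∈ 𝔓.inertia (absoluteGaloisGroup ℚ)) : ρ.twist epsFive σ = ρ σ :=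
  FramedRep.twist_apply_of_eq_one ρ epsFive (epsFive_eq_one_of_mem_inertia_three hv h𝔓 hσ)

/-- `ρ̄ ⊗ ε₅` is tamely ramified above `3` iff `ρ̄` is (`ε₅` is unramified at `3`). [folklore] -/
theorem isTamelyRamifiedAbove_three_twist_epsFive_iff (ρ : ModPGaloisRep ℚ (ZMod 5) 2) :
    FramedGaloisRep.IsTamelyRamifiedAbove 3 (ρ.twist epsFive) ↔ ρ.IsTamelyRamifiedAbove 3 := by
  have key : ∀ (v : HeightOneSpectrum (𝓞 ℚ)), ((3 : ℕ) : 𝓞 ℚ) ∈ v.asIdeal →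
      ∀ 𝔓 ∈ v.primesAbove, ∀ u : ℝ, ∀ σ ∈ absUpperRamificationSubgroup (𝓞 ℚ) 𝔓 u,
        ρ.twist epsFive σ = ρ σ := fun v hv 𝔓 h𝔓 u σ hσ ↦
    twist_epsFive_apply_of_mem_inertia ρ hv h𝔓
      (absUpperRamificationSubgroup_le_inertia_holds (𝓞 ℚ) 𝔓 u (K := ℚ) hσ)
  constructor
  · intro h v hv 𝔓 h𝔓 u hu σ hσ
    rw [← key v hv 𝔓 h𝔓 u σ hσ]
    exact h v hv 𝔓 h𝔓 u hu σ hσ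
  · intro h v hv 𝔓 h𝔓 u hu σ hσ
    rw [key v hv 𝔓 h𝔓 u σ hσ]
    exact h v hv 𝔓 h𝔓 u hu σ hσ

/-- At an arithmetic Frobenius above `3`, `(ρ̄ ⊗ ε₅)(φ) = -ρ̄(φ)`. [folklore] -/
theorem twist_epsFive_apply_of_isArithFrobAt (ρ : ModPGaloisRep ℚ (ZMod 5) 2)
    {v : HeightOneSpectrum (𝓞 ℚ)} (hv : ((3 : ℕ) : 𝓞 ℚ) ∈ v.asIdeal)
    {𝔓 : Ideal (absIntegers (𝓞 ℚ) ℚ)} (h𝔓 : 𝔓 ∈ v.primesAbove) {φ : absoluteGaloisGroup ℚ}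
    (hφ : IsArithFrobAt (𝓞 ℚ) φ 𝔓) : ρ.twist epsFive φ = -ρ φ :=
  FramedRep.twist_apply_of_eq_neg_one ρ epsFive (epsFive_of_isArithFrobAt_three hv h𝔓 hφ)

/-- `ρ̄ ⊗ ε₋₃` is tamely ramified above `3` iff `ρ̄` is — restated next to the `ε₅` version for the
assembly (`isTamelyRamifiedAbove_three_twist_epsNegThree_iff`). [folklore] -/
theorem isTamelyRamifiedAbove_three_twist_epsNegThree_epsFive_iff (ρ : ModPGaloisRep ℚ (ZMod 5) 2) :
    FramedGaloisRep.IsTamelyRamifiedAbove 3 ((ρ.twist epsNegThree).twist epsFive) ↔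
      ρ.IsTamelyRamifiedAbove 3 := by
  rw [isTamelyRamifiedAbove_three_twist_epsFive_iff, isTamelyRamifiedAbove_three_twist_epsNegThree_iff]

end Literature.NumberTheory.Automorphic.BCDT

end
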